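import Literature.NumberTheory.Rogawski1990.TestFunctionsPair
import Literature.NumberTheory.Automorphic.UnitaryGroupTransferAwayPartner
import HarnessLib

/-!
# The endoscopic transfer `f′ ↦ f^H` AWAY from the bad places: `GlobalTransferAwayH S₀ f′ f^H`, its non-vacuity and partners
(Rogawski (1990), Prop. 4.9.1 p. 54; §14.2 p. 233)

Topic `NumberTheory/Automorphic`; namespace `Literature.NumberTheory.Automorphic.UnitaryGroup`.  ONE definition with body (`GlobalTransferAwayH`, a
RELATION — nothing is asserted) and proved theorems; no named fact, no `sorry`, no instance, no notation.

**What is pinned.** For the inner form `G′ = U(H)` and the endoscopic group `H = U(2) × U(1)` (adelic points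
`U(H₂)(𝔸) × U(H₁)(𝔸)`, ★ `PureTensor₂` of `Rogawski1990/TestFunctionsPair`), the transfer `f′ ↦ f′^H` of [Rogawski1990] §14.2 is, AWAY from a
finite set `S₀ ∪ S`, the statement that `f′_v` is the unit `1_{U(H)(𝒪_v)}` and `f^H_v` is the unit `1_{K_{H,v}}`, `K_{H,v} = U(H₂)(𝒪_v) × U(H₁)(𝒪_v)`
hyperspecial: by Prop. 4.9.1 (b) (the fundamental lemma for `U(3)`, [BR₁]) the transfer of a spherical `f_v` at an unramified place is
`ξ̂_H(f_v)`, and `ξ̂_H` is unital — so NO local identification and NO endoscopic embedding enters the away-statement.  What happens AT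
`S₀ ∪ S` and at infinity (transfer factors `Δ_{G/H}`, [LS], Shelstad, Clozel–Delorme) is NOT here: `GlobalTransferAwayH` is an honest
OVER-approximation of the printed transfer, exact off the bad places.

* §1 **(D_H)** `GlobalTransferAwayH S₀ f′ f^H := ∃ T T^H` unramified pure tensors with `⇑f′ = T.eval`, `⇑f^H = T^H.eval`, `T^H.S ⊆ S₀ ∪ T.S`.
* §2 **(N_H)** `exists_arch_bump₂` (Urysohn on the product archimedean group), `exists_globalTransferAwayH_ne_zero`: `f′ ≠ 0`, `f^H ≠ 0` related
  (★ B14 `exists_compactlySupported_isTest_ne_zero` on `G′`; the unit tensor ★ `PureTensor₂.unit` on `H`).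
* §3 **partners**: every unramified `T` on `G′` (in particular every `IsTest` one, every smooth `f′`) has a non-zero `f^H` with
  `GlobalTransferAwayH S₀ (T.toCc) f^H` (`exists_globalTransferAwayH_of_isUnramified ∕ _of_isTest ∕ _of_smooth`) — the satisfiability of the
  ENGINE T1 kit's `TransferH := GlobalTransferAwayH S₀` together with (iv).

Written for the cell `hodgecm-mathlib` (ENGINE T1, line `F0_T1InnerFormTraceIdentity`, brick (b′) ∕ pin (viii)).  HC_CM is proved only modulo the
printed citations until rung 0 closes; this file is unconditional.

## References
* [Rogawski1990] J. Rogawski, Ann. of Math. Stud. 123 (1990), Prop. 4.9.1 p. 54 ((a) existence of `f^H`; (b) `f^H = ξ̂_H(f)` for spherical `f` at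
  unramified `v`), §14.2 p. 233.
* [BorelJacquet1979] A. Borel, H. Jacquet, PSPM 33.1 (1979), §4.1.
-/

set_option autoImplicit false

noncomputable section

open NumberField IsDedekindDomain Filter Set
open scoped Classical

namespace Literature.NumberTheory.Automorphic.UnitaryGroup

variable (L : Type) [Field L] [NumberField L] [IsCMField L] {N N₂ N₁ : ℕ} {H : Matrix (Fin N) (Fin N) L}
  {H₂ : Matrix (Fin N₂) (Fin N₂) L} {H₁ : Matrix (Fin N₁) (Fin N₁) L}

/-! ## §1 (D_H) The endoscopic transfer away from the bad places -/

/-- **`GlobalTransferAwayH S₀ f′ f^H`** — `f′ ∈ C_c(U(H)(𝔸))` and `f^H ∈ C_c(U(H₂)(𝔸) × U(H₁)(𝔸))` are UNRAMIFIED pure tensors `T`, `T^H` (levels =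
integral levels, factors = units off the bad sets) with `T^H.S ⊆ S₀ ∪ T.S`: off `S₀ ∪ S`, `f′_v = 1_{U(H)(𝒪_v)}` and `f^H_v = 1_{U(H₂)(𝒪_v) × U(H₁)(𝒪_v)}`
— the away-from-`S₀ ∪ S` content of [Rogawski1990] §14.2 + Prop. 4.9.1 (b) («unit ↦ unit»).  A RELATION; nothing at the bad places or at
infinity. [cite: Rogawski1990, §4.9 p. 54] -/
def GlobalTransferAwayH (S₀ : Finset (HeightOneSpectrum (𝓞 ↥(maximalRealSubfield L))))
    (f' : CompactlySupportedContinuousMap (cmDatum L N H).Adelic ℂ)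
    (fH : CompactlySupportedContinuousMap ((cmDatum L N₂ H₂).Adelic × (cmDatum L N₁ H₁).Adelic) ℂ) : Prop :=
  ∃ (T : PureTensor L N H) (TH : PureTensor₂ L H₂ H₁), T.IsUnramified ∧ TH.IsUnramified₂ ∧ ⇑f' = T.eval ∧ ⇑fH = TH.eval ∧
    TH.S ⊆ S₀ ∪ T.S

/-- Unfolding of `GlobalTransferAwayH`. [cite: Rogawski1990, §4.9 p. 54] -/
theorem globalTransferAwayH_iff (S₀ : Finset (HeightOneSpectrum (𝓞 ↥(maximalRealSubfield L))))
    (f' : CompactlySupportedContinuousMap (cmDatum L N H).Adelic ℂ)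
    (fH : CompactlySupportedContinuousMap ((cmDatum L N₂ H₂).Adelic × (cmDatum L N₁ H₁).Adelic) ℂ) :
    GlobalTransferAwayH L S₀ f' fH ↔
      ∃ (T : PureTensor L N H) (TH : PureTensor₂ L H₂ H₁), T.IsUnramified ∧ TH.IsUnramified₂ ∧ ⇑f' = T.eval ∧ ⇑fH = TH.eval ∧
        TH.S ⊆ S₀ ∪ T.S :=
  Iff.rfl

/-! ## §2 (N_H) Non-vacuity -/

variable (H₂ H₁) in
/-- A continuous compactly supported real bump `φ` with `φ(1) = 1` on the (locally compact Hausdorff) product archimedean group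
`U(H₂)(L⁺ ⊗ ℝ) × U(H₁)(L⁺ ⊗ ℝ)` (Urysohn). [cite: BorelJacquet1979, §4.1] -/
theorem exists_arch_bump₂ :
    ∃ φ : UnitaryGroup.arch (↥(maximalRealSubfield L)) L (IsCMField.complexConj L) N₂ H₂ ×
        UnitaryGroup.arch (↥(maximalRealSubfield L)) L (IsCMField.complexConj L) N₁ H₁ → ℝ,
      Continuous φ ∧ HasCompactSupport φ ∧ φ 1 = 1 := by
  obtain ⟨φ, hφ1, -, hφc, -⟩ := exists_continuous_one_zero_of_isCompact
    (X := UnitaryGroup.arch (↥(maximalRealSubfield L)) L (IsCMField.complexConj L) N₂ H₂ ×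
      UnitaryGroup.arch (↥(maximalRealSubfield L)) L (IsCMField.complexConj L) N₁ H₁)
    (isCompact_singleton (x := (1 : UnitaryGroup.arch (↥(maximalRealSubfield L)) L (IsCMField.complexConj L) N₂ H₂ ×
      UnitaryGroup.arch (↥(maximalRealSubfield L)) L (IsCMField.complexConj L) N₁ H₁)))
    isClosed_empty (Set.disjoint_empty _)
  exact ⟨φ, φ.continuous, hφc, hφ1 (Set.mem_singleton _)⟩

variable (H₂ H₁) in
/-- **A non-zero unramified `f^H ∈ C_c(U(H₂)(𝔸) × U(H₁)(𝔸))` with empty bad set**: the unit tensor `φ_∞ ⊗ ⊗_v 1_{K_{H,v}}` (★ `PureTensor₂.unit`,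
`PureTensor₂.toCc`), `f^H(1) = 1`. [cite: Rogawski1990, §4.9 p. 54] -/
theorem exists_unit₂_toCc_ne_zero :
    ∃ (TH : PureTensor₂ L H₂ H₁) (fH : CompactlySupportedContinuousMap ((cmDatum L N₂ H₂).Adelic × (cmDatum L N₁ H₁).Adelic) ℂ),
      TH.IsUnramified₂ ∧ TH.S = ∅ ∧ ⇑fH = TH.eval ∧ fH ≠ 0 := by
  obtain ⟨φ, hφ, hφc, hφ1⟩ := exists_arch_bump₂ L H₂ H₁
  let TH : PureTensor₂ L H₂ H₁ := PureTensor₂.unit L H₂ H₁ fun k => (φ k : ℂ)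
  have hK : TH.IsUnramified₂ := PureTensor₂.unit_isUnramified₂ _
  have ha : Continuous TH.arch := Complex.continuous_ofReal.comp hφ
  have hac : HasCompactSupport TH.arch := hφc.comp_left Complex.ofReal_zero
  have hl : ∀ v ∈ TH.S, Continuous (TH.loc v) := fun v hv => absurd hv (Finset.notMem_empty v)
  have hlc : ∀ v ∈ TH.S, HasCompactSupport (TH.loc v) := fun v hv => absurd hv (Finset.notMem_empty v)
  refine ⟨TH, TH.toCc hK ha hac hl hlc, hK, rfl, rfl, fun h0 => ?_⟩
  have h1 : TH.eval 1 = 1 := by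
    rw [show TH = PureTensor₂.unit L H₂ H₁ fun k => (φ k : ℂ) from rfl, PureTensor₂.unit_eval_one, hφ1, Complex.ofReal_one]
  have h := DFunLike.congr_fun h0 (1 : (cmDatum L N₂ H₂).Adelic × (cmDatum L N₁ H₁).Adelic)
  rw [PureTensor₂.toCc_apply, CompactlySupportedContinuousMap.zero_apply, h1] at h
  exact one_ne_zero h

variable (H H₂ H₁) in
/-- **(N_H) Non-vacuity of `GlobalTransferAwayH`**: for every `S₀` there are `f′ ≠ 0` (a smooth pure tensor, ★ `exists_compactlySupported_isTest_ne_zero`)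
and `f^H ≠ 0` (the unit tensor) with `GlobalTransferAwayH S₀ f′ f^H`. [cite: Rogawski1990, §4.9 p. 54] -/
theorem exists_globalTransferAwayH_ne_zero (S₀ : Finset (HeightOneSpectrum (𝓞 ↥(maximalRealSubfield L)))) :
    ∃ (f' : CompactlySupportedContinuousMap (cmDatum L N H).Adelic ℂ)
      (fH : CompactlySupportedContinuousMap ((cmDatum L N₂ H₂).Adelic × (cmDatum L N₁ H₁).Adelic) ℂ),
      f' ≠ 0 ∧ fH ≠ 0 ∧ GlobalTransferAwayH L S₀ f' fH := by
  obtain ⟨f', ⟨T, hT, hf'⟩, -, hf'0⟩ := exists_compactlySupported_isTest_ne_zero L N H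
  obtain ⟨TH, fH, hTH, hS, hfH, hfH0⟩ := exists_unit₂_toCc_ne_zero L H₂ H₁
  exact ⟨f', fH, hf'0, hfH0, T, TH, hT.isUnramified, hTH, hf', hfH, by rw [hS]; exact Finset.empty_subset _⟩

/-! ## §3 Partners: every unramified `f′` has an away-transfer `f^H` -/

variable (H₂ H₁) in
/-- **Every unramified pure tensor `T` on `G′` has a non-zero endoscopic away-partner**: `GlobalTransferAwayH S₀ (T.toCc …) f^H` with `f^H` the unit
tensor (bad set `∅ ⊆ S₀ ∪ S`). [cite: Rogawski1990, §4.9 p. 54] -/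
theorem exists_globalTransferAwayH_of_isUnramified (S₀ : Finset (HeightOneSpectrum (𝓞 ↥(maximalRealSubfield L))))
    (T : PureTensor L N H) (hT : T.IsUnramified) (harch : Continuous T.arch) (harch' : HasCompactSupport T.arch)
    (hloc : ∀ v ∈ T.S, Continuous (T.loc v)) (hloc' : ∀ v ∈ T.S, HasCompactSupport (T.loc v)) :
    ∃ fH : CompactlySupportedContinuousMap ((cmDatum L N₂ H₂).Adelic × (cmDatum L N₁ H₁).Adelic) ℂ,
      fH ≠ 0 ∧ GlobalTransferAwayH L S₀ (T.toCc hT harch harch' hloc hloc') fH := by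
  obtain ⟨TH, fH, hTH, hS, hfH, hfH0⟩ := exists_unit₂_toCc_ne_zero L H₂ H₁
  exact ⟨fH, hfH0, T, TH, hT, hTH, rfl, hfH, by rw [hS]; exact Finset.empty_subset _⟩

variable (H₂ H₁) in
/-- The same for an `IsTest` tensor (side conditions of `toCc` discharged from `IsTest`). [cite: Rogawski1990, §4.9 p. 54] -/
theorem exists_globalTransferAwayH_of_isTest (S₀ : Finset (HeightOneSpectrum (𝓞 ↥(maximalRealSubfield L))))
    (T : PureTensor L N H) (hT : T.IsTest) :
    ∃ fH : CompactlySupportedContinuousMap ((cmDatum L N₂ H₂).Adelic × (cmDatum L N₁ H₁).Adelic) ℂ,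
      fH ≠ 0 ∧ GlobalTransferAwayH L S₀
        (T.toCc hT.isUnramified hT.isArchTest.continuous_arch hT.isArchTest.hasCompactSupport_arch
          (fun v _ => PureTensor.continuous_loc hT.isUnramified hT.isFinSmooth v)
          (fun v _ => PureTensor.hasCompactSupport_loc hT.isUnramified hT.isFinSmooth v)) fH :=
  exists_globalTransferAwayH_of_isUnramified L H₂ H₁ S₀ T hT.isUnramified _ _ _ _

variable (H₂ H₁) in
/-- **Satisfiability of `TransferH := GlobalTransferAwayH S₀` with pin (iv)**: every SMOOTH `f′` (`∃ T, T.IsTest ∧ ⇑f′ = T.eval`) has a non-zero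
`f^H` with `GlobalTransferAwayH S₀ f′ f^H`. [cite: Rogawski1990, §4.9 p. 54] -/
theorem exists_globalTransferAwayH_of_smooth (S₀ : Finset (HeightOneSpectrum (𝓞 ↥(maximalRealSubfield L))))
    (f' : CompactlySupportedContinuousMap (cmDatum L N H).Adelic ℂ) (hf' : ∃ T : PureTensor L N H, T.IsTest ∧ ⇑f' = T.eval) :
    ∃ fH : CompactlySupportedContinuousMap ((cmDatum L N₂ H₂).Adelic × (cmDatum L N₁ H₁).Adelic) ℂ,
      fH ≠ 0 ∧ GlobalTransferAwayH L S₀ f' fH := by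
  obtain ⟨T, hT, hf'T⟩ := hf'
  obtain ⟨TH, fH, hTH, hS, hfH, hfH0⟩ := exists_unit₂_toCc_ne_zero L H₂ H₁
  exact ⟨fH, hfH0, T, TH, hT.isUnramified, hTH, hf'T, hfH, by rw [hS]; exact Finset.empty_subset _⟩

end Literature.NumberTheory.Automorphic.UnitaryGroup

end
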